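import Mathlib.FieldTheory.Finite.Basic
import Literature.Computability.Complexity.SymPlusProofs
import Literature.Computability.MetaComplexity.SmolenskyProperty
import HarnessLib

/-!
# Razborov–Smolensky approximation, I: polynomial semantics of an `AC⁰[p]` circuit

Groundwork for the named fact `Literature.Computability.Learning.cikk_learn_AC0Mod` (CIKK 2016,
Cor. 5.4, via the Razborov–Smolensky natural property, CIKK Thm. 5.3). This file and its sequel
`RazborovSmolenskyApprox.lean` prove the **Razborov–Smolensky approximation lemma** (Razborov
1987; Smolensky 1987, Lemmas 1–2): a circuit over `{¬, ∧, ∨, MOD_p}` (`accBasis p`, `p` prime) of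
`acDepth ≤ d` and `s` gates agrees, outside an exceptional set of at most `s · 2ⁿ / p^ℓ` inputs,
with a polynomial function over `GF(p)` of degree at most `((p-1)ℓ)^d`.

Here: the randomized polynomial semantics and its two deterministic properties.

* `polyOpL ℓ c g` — Smolensky's polynomial for one gate `g` with trial coefficients
  `c : ℕ → ℕ → 𝔽_p` (`ℓ` trials): `¬v ↦ 1 - v`; `MOD_p(v) ↦ (Σ vₐ)^{p-1}` (exact, Fermat);
  `∨(v) ↦ 1 - Π_{t<ℓ} (1 - (Σₐ c t a · vₐ)^{p-1})`; `∧(v) ↦ Π_{t<ℓ} (1 - (Σₐ c t a · (1 - vₐ))^{p-1})`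
  (Smolensky 1987, Lemma 1: "a polynomial of degree at most `(p-1)·l` such that `f` and `f̃`
  differ on at most `2^{n-l}` assignments" — here with the sharper field-size count `p^{-ℓ}`);
  gates are dispatched on `accCode p g.fn` (`Williams2014.lean`).
* `avals ℓ ρ x gs` — the values of all gates under this semantics (a fold like `transcript`),
  `apx ℓ ρ C` — the resulting function `{0,1}ⁿ → 𝔽_p` of the circuit, for a seed reader
  `ρ : ℕ → ℕ → ℕ → 𝔽_p` (gate, trial, argument position).
* **Degree** (`apx_mem_lowDeg`): for `ℓ ≥ 1`, `apx ℓ ρ C ∈ lowDeg 𝔽_p n (((p-1)ℓ)^{acDepth C})`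
  (Smolensky 1987, Lemma 2: degree multiplies by `(p-1)ℓ` per level; negations are free).
* **Exactness off the error set** (`apx_eq_bit_eval`): if at input `x` no gate's polynomial errs
  on the TRUE values of its arguments (`¬ GateErr`), then `apx ℓ ρ C x = [C.eval x]`.

The probabilistic count of `GateErr` and the choice of a good seed are in part II.

## References

* R. Smolensky, *Algebraic methods in the theory of lower bounds for Boolean circuit
  complexity*, STOC 1987, Lemmas 1–2 [Smolensky1987].
* A. A. Razborov, *Lower bounds on the size of bounded depth circuits over a complete basis with
  logical addition*, Math. Notes 41 (1987) (the approximation method for `{∧, ⊕}`).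
* M. Carmosino, R. Impagliazzo, V. Kabanets, A. Kolokolova, *Learning algorithms from natural
  proofs*, CCC 2016, Thm. 5.3 [CarmosinoImpagliazzoKabanetsKolokolova2016].
-/

noncomputable section

namespace Literature.Computability.MetaComplexity

open Finset Literature.Computability.Complexity Literature.Computability.Complexity.GateList

namespace Smolensky

variable {F : Type*} [Field F] {n : ℕ}

/-! ### More closure properties of the degree filtration -/

/-- `1 ∈ lowDeg D`. [folklore] -/
theorem one_mem_lowDeg (D : ℕ) : (1 : CubeFn F n) ∈ lowDeg F n D := by
  rw [← mono_empty]
  exact mono_mem_lowDeg (by simp)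

/-- Powers: `u ∈ lowDeg D → u^k ∈ lowDeg (k D)`. [folklore] -/
theorem pow_mem_lowDeg {D : ℕ} {u : CubeFn F n} (hu : u ∈ lowDeg F n D) :
    ∀ k : ℕ, u ^ k ∈ lowDeg F n (k * D)
  | 0 => by
    rw [pow_zero, zero_mul]
    exact one_mem_lowDeg 0
  | k + 1 => by
    rw [pow_succ, add_mul, one_mul]
    exact mul_mem_lowDeg_add (pow_mem_lowDeg hu k) hu

/-- Products: degrees add up. [folklore] -/
theorem prod_mem_lowDeg {α : Type*} (T : Finset α) {u : α → CubeFn F n} {D : ℕ}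
    (h : ∀ t ∈ T, u t ∈ lowDeg F n D) : ∏ t ∈ T, u t ∈ lowDeg F n (T.card * D) := by
  induction T using Finset.cons_induction with
  | empty => simpa using one_mem_lowDeg (F := F) (n := n) 0
  | cons a T ha ih =>
    rw [Finset.prod_cons, Finset.card_cons, show (T.card + 1) * D = D + T.card * D by ring]
    exact mul_mem_lowDeg_add (h a (Finset.mem_cons_self a T)) (ih fun t ht =>
      h t (Finset.mem_cons.2 (Or.inr ht)))

/-- The input literal `x ↦ [xᵢ]` has degree `1`. [folklore] -/
theorem bitFn_mem_lowDeg (i : Fin n) {D : ℕ} (hD : 1 ≤ D) :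
    (fun x : Fin n → Bool => if x i then (1 : F) else 0) ∈ lowDeg F n D := by
  have h : (fun x : Fin n → Bool => if x i then (1 : F) else 0) = mono F {i} := by
    funext x
    simp [mono]
  rw [h]
  exact mono_mem_lowDeg (by simpa using hD)

/-! ### Smolensky's polynomial for one gate -/

variable {p : ℕ} [Fact p.Prime]

/-- A bit as an element of `𝔽_p`. [folklore] -/
def bit (p : ℕ) (b : Bool) : ZMod p := if b then 1 else 0

/-- `bit true = 1`. [folklore] -/
@[simp] theorem bit_true : bit p true = 1 := rfl

/-- `bit false = 0`. [folklore] -/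
@[simp] theorem bit_false : bit p false = 0 := rfl

/-- A seed reader: the coefficient of argument position `a` in trial `t` at gate `j`.
[cite: Smolensky1987, Lemma 1] -/
abbrev Seed (p : ℕ) : Type := ℕ → ℕ → ℕ → ZMod p

/-- **Smolensky's polynomial for one gate** with local trial coefficients `c t a`: NOT and `MOD_p`
are represented exactly (`1 - v`, `(Σ vₐ)^{p-1}`), OR by `1 - Π_{t<ℓ} (1 - (Σₐ c t a vₐ)^{p-1})`
and AND dually; any other gate function (not in `accBasis p`) is sent, harmlessly, to the `MOD_p`
formula. [cite: Smolensky1987, Lemma 1] -/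
def polyOpL (ℓ : ℕ) (c : ℕ → ℕ → ZMod p) (g : Gate (Fin n)) (v : Fin g.arity → ZMod p) : ZMod p :=
  if accCode p g.fn = 0 then 1 - ∑ a, v a
  else if accCode p g.fn = 1 then
    ∏ t ∈ range ℓ, (1 - (∑ a : Fin g.arity, c t (a : ℕ) * (1 - v a)) ^ (p - 1))
  else if accCode p g.fn = 2 then
    1 - ∏ t ∈ range ℓ, (1 - (∑ a : Fin g.arity, c t (a : ℕ) * v a) ^ (p - 1))
  else (∑ a, v a) ^ (p - 1)

/-- The gate polynomial read from a seed reader at gate index `j`. [cite: Smolensky1987, Lemma 1] -/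
def polyOp (ℓ : ℕ) (ρ : Seed p) (j : ℕ) (g : Gate (Fin n)) (v : Fin g.arity → ZMod p) : ZMod p :=
  polyOpL ℓ (ρ j) g v

/-- The value of a wire in `𝔽_p`, given the input and the values of the earlier gates.
[folklore] -/
def wireF (x : Fin n → Bool) (vals : List (ZMod p)) : Fin n ⊕ ℕ → ZMod p
  | .inl i => bit p (x i)
  | .inr m => vals.getD m 0

/-- **The polynomial semantics of a gate list**: the values of all gates when every gate is
replaced by its polynomial (a fold in program order, like `transcript`; the gate index is the
number of values computed so far). [cite: Smolensky1987, Lemma 2] -/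
def avals (ℓ : ℕ) (ρ : Seed p) (x : Fin n → Bool) (gs : List (Gate (Fin n))) : List (ZMod p) :=
  gs.foldl (fun vs g => vs ++ [polyOp ℓ ρ vs.length g fun a => wireF x vs (g.args a)]) []

/-- **The approximating function** of a circuit for the seed reader `ρ`: the polynomial value of
the output wire. [cite: Smolensky1987, Lemma 2] -/
def apx (ℓ : ℕ) (ρ : Seed p) (C : Circuit (Fin n)) : CubeFn (ZMod p) n :=
  fun x => wireF x (avals ℓ ρ x C.gates) C.output

/-! ### The fold: prefixes and the gate equations -/

section Fold

variable (ℓ : ℕ) (ρ : Seed p) (x : Fin n → Bool)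

/-- One more gate appends its polynomial value. [folklore] -/
theorem avals_append_singleton (gs : List (Gate (Fin n))) (g : Gate (Fin n)) :
    avals ℓ ρ x (gs ++ [g]) =
      avals ℓ ρ x gs ++ [polyOp ℓ ρ (avals ℓ ρ x gs).length g fun a =>
        wireF x (avals ℓ ρ x gs) (g.args a)] := by
  simp [avals, List.foldl_append]

/-- `avals` has one entry per gate. [folklore] -/
@[simp] theorem length_avals (gs : List (Gate (Fin n))) : (avals ℓ ρ x gs).length = gs.length := by
  induction gs using List.reverseRecOn with
  | nil => rfl
  | append_singleton gs g ih => simp [avals_append_singleton, ih]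

/-- The values of a prefix are a prefix of the values. [folklore] -/
theorem avals_append (gs sfx : List (Gate (Fin n))) :
    ∃ t, avals ℓ ρ x (gs ++ sfx) = avals ℓ ρ x gs ++ t := by
  induction sfx using List.reverseRecOn with
  | nil => exact ⟨[], by simp⟩
  | append_singleton sfx g ih =>
    obtain ⟨t, ht⟩ := ih
    refine ⟨t ++ [polyOp ℓ ρ (avals ℓ ρ x (gs ++ sfx)).length g fun a =>
      wireF x (avals ℓ ρ x (gs ++ sfx)) (g.args a)], ?_⟩
    rw [← List.append_assoc, avals_append_singleton, ht, List.append_assoc]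

/-- Entries of a prefix are unchanged by later gates. [folklore] -/
theorem getD_avals_append (gs sfx : List (Gate (Fin n))) {m : ℕ} (hm : m < gs.length) :
    (avals ℓ ρ x (gs ++ sfx)).getD m 0 = (avals ℓ ρ x gs).getD m 0 := by
  obtain ⟨t, ht⟩ := avals_append ℓ ρ x gs sfx
  rw [ht, List.getD_eq_getElem?_getD, List.getD_eq_getElem?_getD,
    List.getElem?_append_left (by simpa using hm)]

/-- Wires into a prefix are unchanged by later gates. [folklore] -/
theorem wireF_avals_append (gs sfx : List (Gate (Fin n))) (u : Fin n ⊕ ℕ)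
    (hu : ∀ m, u = .inr m → m < gs.length) :
    wireF x (avals ℓ ρ x (gs ++ sfx)) u = wireF x (avals ℓ ρ x gs) u := by
  cases u with
  | inl i => rfl
  | inr m => exact getD_avals_append ℓ ρ x gs sfx (hu m rfl)

/-- **The polynomial gate equations**: entry `j` of `avals` is the polynomial of gate `j` applied
to the (polynomial) values of its argument wires. [cite: Smolensky1987, Lemma 2] -/
theorem getD_avals_eq_polyOp (C : Circuit (Fin n)) (j : ℕ) (hj : j < C.gates.length) :
    (avals ℓ ρ x C.gates).getD j 0 =
      polyOp ℓ ρ j C.gates[j] fun a => wireF x (avals ℓ ρ x C.gates) (C.gates[j].args a) := by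
  have hsplit : C.gates = C.gates.take j ++ [C.gates[j]] ++ C.gates.drop (j + 1) := by
    conv_lhs => rw [← List.take_append_drop (j + 1) C.gates]
    rw [List.take_add_one, List.getElem?_eq_getElem hj]
    rfl
  have hlenj : (C.gates.take j).length = j := List.length_take_of_le hj.le
  -- entry `j`
  have hget : (avals ℓ ρ x C.gates).getD j 0 =
      polyOp ℓ ρ j C.gates[j] fun a => wireF x (avals ℓ ρ x (C.gates.take j)) (C.gates[j].args a) := by
    obtain ⟨t, ht⟩ := avals_append ℓ ρ x (C.gates.take j ++ [C.gates[j]]) (C.gates.drop (j + 1))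
    rw [← hsplit] at ht
    rw [ht, avals_append_singleton, List.getD_eq_getElem?_getD, List.append_assoc,
      List.getElem?_append_right (by simp [hlenj]), length_avals, hlenj, Nat.sub_self]
    simp
  have key : ∀ u : Fin n ⊕ ℕ, (∀ m, u = .inr m → m < j) →
      wireF x (avals ℓ ρ x C.gates) u = wireF x (avals ℓ ρ x (C.gates.take j)) u := by
    intro u hu
    have h := wireF_avals_append ℓ ρ x (C.gates.take j) (C.gates.drop j) u (by rw [hlenj]; exact hu)
    rwa [List.take_append_drop] at h
  rw [hget]
  congr 1
  funext a
  exact (key _ fun m hm => C.wf j hj a m hm).symm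

end Fold

/-! ### Degree -/

section Degree

variable (ℓ : ℕ)

/-- **Degree of one gate polynomial** (Smolensky 1987, Lemma 2, induction step): if every
argument function has degree `≤ M^S`, `M = (p-1)ℓ ≥ 1`, then the gate's polynomial, as a
function of the input, has degree `≤ M^{w + S}` where `w = acWeight g.fn` (`0` for NOT, else `1`).
[cite: Smolensky1987, Lemma 2] -/
theorem polyOpL_fn_mem_lowDeg (hℓ : 1 ≤ ℓ) (c : ℕ → ℕ → ZMod p) (g : Gate (Fin n)) {S : ℕ}
    (W : Fin g.arity → CubeFn (ZMod p) n)
    (hW : ∀ a, W a ∈ lowDeg (ZMod p) n (((p - 1) * ℓ) ^ S)) :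
    (fun x => polyOpL ℓ c g fun a => W a x) ∈
      lowDeg (ZMod p) n (((p - 1) * ℓ) ^ (acWeight g.fn + S)) := by
  have hp : 2 ≤ p := (Fact.out : p.Prime).two_le
  set M : ℕ := (p - 1) * ℓ with hM
  have hM1 : 1 ≤ M := Nat.mul_pos (by omega) hℓ
  -- linear forms in the arguments have degree `≤ M^S`
  have hsum : (∑ a, W a) ∈ lowDeg (ZMod p) n (M ^ S) := Submodule.sum_mem _ fun a _ => hW a
  have hlin : ∀ t, (∑ a : Fin g.arity, c t (a : ℕ) • W a) ∈ lowDeg (ZMod p) n (M ^ S) := fun t =>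
    Submodule.sum_mem _ fun a _ => Submodule.smul_mem _ _ (hW a)
  have hlin' : ∀ t, (∑ a : Fin g.arity, c t (a : ℕ) • (1 - W a)) ∈ lowDeg (ZMod p) n (M ^ S) :=
    fun t =>
    Submodule.sum_mem _ fun a _ => Submodule.smul_mem _ _
      (Submodule.sub_mem _ (one_mem_lowDeg _) (hW a))
  -- `Π_{t<ℓ} (1 - u_t^{p-1})` has degree `≤ M^{S+1}` when each `u_t` has degree `≤ M^S`
  have hprod : ∀ u : ℕ → CubeFn (ZMod p) n, (∀ t, u t ∈ lowDeg (ZMod p) n (M ^ S)) →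
      ∏ t ∈ range ℓ, (1 - u t ^ (p - 1)) ∈ lowDeg (ZMod p) n (M ^ (1 + S)) := by
    intro u hu
    have h := prod_mem_lowDeg (range ℓ) (u := fun t => 1 - u t ^ (p - 1)) (D := (p - 1) * M ^ S)
      fun t _ => Submodule.sub_mem _ (one_mem_lowDeg _) (pow_mem_lowDeg (hu t) _)
    rw [Finset.card_range] at h
    have e : ℓ * ((p - 1) * M ^ S) = M ^ (1 + S) := by rw [pow_add, pow_one, hM]; ring
    rwa [e] at h
  by_cases h0 : accCode p g.fn = 0
  · -- NOT: `1 - Σ v`, weight `0`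
    have hfn : g.fn = GateFn.not := BT.fn_eq_not_of_accCode h0
    have e : (fun x => polyOpL ℓ c g fun a => W a x) = 1 - ∑ a, W a := by
      funext x
      simp [polyOpL, h0, Finset.sum_apply]
    rw [e, hfn, acWeight_not, zero_add]
    exact Submodule.sub_mem _ (one_mem_lowDeg _) hsum
  have hw : acWeight g.fn = 1 := BT.acWeight_eq_one_of_accCode_ne h0
  rw [hw]
  by_cases h1 : accCode p g.fn = 1
  · -- AND
    have e : (fun x => polyOpL ℓ c g fun a => W a x) =
        ∏ t ∈ range ℓ, (1 - (∑ a : Fin g.arity, c t (a : ℕ) • (1 - W a)) ^ (p - 1)) := by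
      funext x
      simp [polyOpL, h1, Finset.sum_apply, Finset.prod_apply]
    rw [e]
    exact hprod _ hlin'
  by_cases h2 : accCode p g.fn = 2
  · -- OR
    have e : (fun x => polyOpL ℓ c g fun a => W a x) =
        1 - ∏ t ∈ range ℓ, (1 - (∑ a : Fin g.arity, c t (a : ℕ) • W a) ^ (p - 1)) := by
      funext x
      simp [polyOpL, h2, Finset.sum_apply, Finset.prod_apply]
    rw [e]
    exact Submodule.sub_mem _ (one_mem_lowDeg _) (hprod _ hlin)
  · -- MOD (and anything else): `(Σ v)^{p-1}`
    have e : (fun x => polyOpL ℓ c g fun a => W a x) = (∑ a, W a) ^ (p - 1) := by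
      funext x
      simp [polyOpL, h0, h1, h2, Finset.sum_apply]
    rw [e]
    refine lowDeg_mono ?_ (pow_mem_lowDeg hsum (p - 1))
    calc (p - 1) * M ^ S ≤ M * M ^ S := Nat.mul_le_mul_right _ (Nat.le_mul_of_pos_right _ hℓ)
      _ = M ^ (1 + S) := by rw [pow_add, pow_one]

/-- **Degree of the polynomial semantics** (Smolensky 1987, Lemma 2): for `ℓ ≥ 1`, the value of
gate `j` of the prefix of length `k`, as a function of the input, has degree at most
`((p-1)ℓ)^{depth of gate j}` (`acWeight`-depth: negations free). No hypothesis on the basis is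
needed (foreign gates are sent to the `MOD_p` formula). [cite: Smolensky1987, Lemma 2] -/
theorem avals_mem_lowDeg (hℓ : 1 ≤ ℓ) (ρ : Seed p) (C : Circuit (Fin n)) :
    ∀ k, k ≤ C.gates.length → ∀ j, j < k →
      (fun x => (avals ℓ ρ x (C.gates.take k)).getD j 0) ∈
        lowDeg (ZMod p) n (((p - 1) * ℓ) ^ ((wdepths acWeight (C.gates.take k)).getD j 0)) := by
  have hp : 2 ≤ p := (Fact.out : p.Prime).two_le
  have hM1 : 1 ≤ (p - 1) * ℓ := Nat.mul_pos (by omega) hℓ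
  intro k
  induction k with
  | zero => intro _ j hj; exact absurd hj (Nat.not_lt_zero j)
  | succ k ih =>
    intro hk j hj
    have hk' : k < C.gates.length := hk
    have htake : C.gates.take (k + 1) = C.gates.take k ++ [C.gates[k]] := by
      rw [List.take_add_one, List.getElem?_eq_getElem hk']
      rfl
    have hlenk : (C.gates.take k).length = k := List.length_take_of_le hk'.le
    rw [htake]
    rcases Nat.lt_succ_iff_lt_or_eq.1 hj with hjk | rfl
    · -- an old gate
      have e1 : (fun x => (avals ℓ ρ x (C.gates.take k ++ [C.gates[k]])).getD j 0) =
          fun x => (avals ℓ ρ x (C.gates.take k)).getD j 0 := by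
        funext x
        exact getD_avals_append ℓ ρ x _ _ (by rw [hlenk]; exact hjk)
      have e2 : (wdepths acWeight (C.gates.take k ++ [C.gates[k]])).getD j 0 =
          (wdepths acWeight (C.gates.take k)).getD j 0 := by
        rw [wdepths_append_singleton, List.getD_eq_getElem?_getD, List.getD_eq_getElem?_getD,
          List.getElem?_append_left (by rw [length_wdepths, hlenk]; exact hjk)]
      rw [e1, e2]
      exact ih hk'.le j hjk
    · -- the new gate `g = C.gates[k]` at position `j = k`
      set g := C.gates[j] with hg
      have e1 : (fun x => (avals ℓ ρ x (C.gates.take j ++ [g])).getD j 0) =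
          fun x => polyOpL ℓ (ρ j) g fun a => wireF x (avals ℓ ρ x (C.gates.take j)) (g.args a) := by
        funext x
        rw [avals_append_singleton, List.getD_eq_getElem?_getD,
          List.getElem?_append_right (by rw [length_avals, hlenk]), length_avals, hlenk,
          Nat.sub_self]
        simp [polyOp]
      have e2 : (wdepths acWeight (C.gates.take j ++ [g])).getD j 0 =
          acWeight g.fn + univ.sup fun a => wireDepthOf (wdepths acWeight (C.gates.take j)) (g.args a) := by
        have h := getD_wdepths_append_singleton acWeight (C.gates.take j) g
        rwa [hlenk] at h
      rw [e1, e2]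
      refine polyOpL_fn_mem_lowDeg ℓ hℓ (ρ j) g
        (fun a => fun x => wireF x (avals ℓ ρ x (C.gates.take j)) (g.args a)) fun a => ?_
      -- each argument wire has degree `≤ M^{its depth} ≤ M^{sup}`
      have hle : wireDepthOf (wdepths acWeight (C.gates.take j)) (g.args a) ≤
          univ.sup fun a => wireDepthOf (wdepths acWeight (C.gates.take j)) (g.args a) :=
        Finset.le_sup (f := fun a => wireDepthOf (wdepths acWeight (C.gates.take j)) (g.args a))
          (Finset.mem_univ a)
      refine lowDeg_mono (Nat.pow_le_pow_right hM1 hle) ?_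
      cases hga : g.args a with
      | inl i =>
        simp only [wireF, wireDepthOf_inl, pow_zero]
        exact bitFn_mem_lowDeg i le_rfl
      | inr m =>
        have hm : m < j := C.wf j hk' a m hga
        simp only [wireF, wireDepthOf_inr]
        exact ih hk'.le m hm

/-- **The approximating function has degree `≤ ((p-1)ℓ)^{acDepth C}`** (for `ℓ ≥ 1`).
[cite: Smolensky1987, Lemma 2] -/
theorem apx_mem_lowDeg (hℓ : 1 ≤ ℓ) (ρ : Seed p) (C : Circuit (Fin n)) :
    apx ℓ ρ C ∈ lowDeg (ZMod p) n (((p - 1) * ℓ) ^ C.acDepth) := by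
  have hp : 2 ≤ p := (Fact.out : p.Prime).two_le
  have hM1 : 1 ≤ (p - 1) * ℓ := Nat.mul_pos (by omega) hℓ
  unfold apx
  cases ho : C.output with
  | inl i =>
    simp only [wireF]
    exact bitFn_mem_lowDeg i (Nat.one_le_pow _ _ hM1)
  | inr m =>
    have hm : m < C.gates.length := C.wf_output m ho
    have h := avals_mem_lowDeg ℓ hℓ ρ C C.gates.length le_rfl m hm
    rw [List.take_length] at h
    have hd : C.acDepth = (wdepths acWeight C.gates).getD m 0 := by
      rw [Circuit.acDepth, circuit_depthWith, ho, wireDepthOf_inr]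
    simp only [wireF]
    rwa [hd]

end Degree

/-! ### Exactness off the error set -/

section Exact

variable (ℓ : ℕ)

/-- **The local error event**: the polynomial of gate `g`, applied to the TRUE values `v` of its
arguments, differs from the true value of the gate. [cite: Smolensky1987, Lemma 1] -/
def LocErr (c : ℕ → ℕ → ZMod p) (g : Gate (Fin n)) (v : Fin g.arity → Bool) : Prop :=
  polyOpL ℓ c g (fun a => bit p (v a)) ≠ bit p (g.op v)

/-- The true values of the argument wires of gate `j` at input `x`. [folklore] -/
def trueArgs (C : Circuit (Fin n)) (x : Fin n → Bool) (j : ℕ) (hj : j < C.gates.length) :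
    Fin C.gates[j].arity → Bool :=
  fun a => wireVal x (transcript x [] C.gates) (C.gates[j].args a)

/-- **The error event of gate `j` at input `x`** under the seed reader `ρ`. [cite: Smolensky1987, Lemma 2] -/
def GateErr (ρ : Seed p) (C : Circuit (Fin n)) (x : Fin n → Bool) (j : ℕ) : Prop :=
  ∃ hj : j < C.gates.length, LocErr ℓ (ρ j) C.gates[j] (trueArgs C x j hj)

/-- **No gate errs ⇒ the polynomial semantics is the Boolean one**: every entry of `avals` is
the bit of the corresponding entry of the true transcript. [cite: Smolensky1987, Lemma 2] -/
theorem getD_avals_eq_bit (ρ : Seed p) (C : Circuit (Fin n)) (x : Fin n → Bool)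
    (h : ∀ j, j < C.gates.length → ¬ GateErr ℓ ρ C x j) :
    ∀ j, j < C.gates.length →
      (avals ℓ ρ x C.gates).getD j 0 = bit p ((transcript x [] C.gates).getD j false) := by
  intro j
  induction j using Nat.strong_induction_on with
  | _ j ih =>
    intro hj
    rw [getD_avals_eq_polyOp ℓ ρ x C j hj, getD_transcript_eq_gateValue C x j hj]
    have hargs : (fun a => wireF x (avals ℓ ρ x C.gates) (C.gates[j].args a)) =
        fun a => bit p (trueArgs C x j hj a) := by
      funext a
      unfold trueArgs
      cases hga : C.gates[j].args a with
      | inl i => rfl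
      | inr m =>
        have hm : m < j := C.wf j hj a m hga
        simp only [wireF, wireVal]
        exact ih m hm (hm.trans hj)
    have hne := h j hj
    simp only [GateErr, LocErr, hj, exists_true_left, ne_eq, not_not] at hne
    rw [polyOp, hargs, hne]
    rfl

/-- **Off the error set the approximating function is the circuit's value.**
[cite: Smolensky1987, Lemma 2] -/
theorem apx_eq_bit_eval (ρ : Seed p) (C : Circuit (Fin n)) (x : Fin n → Bool)
    (h : ∀ j, j < C.gates.length → ¬ GateErr ℓ ρ C x j) :
    apx ℓ ρ C x = bit p (C.eval x) := by
  rw [apx, eval_eq_wireVal]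
  cases ho : C.output with
  | inl i => rfl
  | inr m =>
    simp only [wireF, wireVal]
    exact getD_avals_eq_bit ℓ ρ C x h m (C.wf_output m ho)

end Exact

end Smolensky

end Literature.Computability.MetaComplexity
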